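import Literature.Probability.RandomPlanarGeometry.HexSAWBrickWallStripFugacityWidthOneUniformAmplitude
import Literature.Probability.RandomPlanarGeometry.HexSAWBrickWallStripFugacityWidthOneContactSusceptibilityUniform
import Literature.Probability.Moments.FiniteLogLaplaceCumulants
import Literature.Analysis.Calculus.QuasiLinearSecondDerivative
import Mathlib.Analysis.Calculus.ContDiff.Basic
import Mathlib.Analysis.Calculus.IteratedDeriv.Lemmas
import HarnessLib

/-!
# The variance of the contact number of the two-fugacity one-cell strip: `Var_{N,y,z}(bc)/N → ∂b/∂log y`

Topic `Literature/Probability/RandomPlanarGeometry` (continues `HexSAWBrickWallStripFugacityWidthOneUniformAmplitude.lean`: uniform two-term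
asymptotics `log C_{1,N}(y,z) = N log μ₁ + log A_{N mod 2} + o(1/N)` uniformly on compact `y`-intervals; `…ContactSusceptibility.lean`: the
free energy `Λ(A) = log μ₁(e^A, e^B)` has `Λ' = b`, `Λ'' = m₂₂/D`; `Literature/Probability/Moments/FiniteLogLaplaceCumulants.lean` and
`Literature/Analysis/Calculus/QuasiLinearSecondDerivative.lean`: the model-free engine «`F_N = Nφ + G + r_N`, `Nε_N → 0`, no `1/N`-oscillation
of `F_N''` ⇒ `F_N''(0)/N → φ''(0)`»).  For the width-one brick-wall strip `S₁` with wall fugacities `y` (bottom), `z` (top) and the Gibbs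
measure `P_{N,y,z} ∝ y^{bc} z^{tc}` on `N`-step walks, the number `bc` of bottom contacts satisfies a law of large numbers `⟨bc⟩/N → b(y,z)`
(tree, `tendsto_meanContacts_div`) and a full large-deviation principle (tree).  THIS FILE PROVES THE VARIANCE THEOREM
(«DOOR-ap5-g24 item 2», the last open item of the contact programme short of the CLT):

  ★★★★ `tendsto_varContacts_div`: `Var_{N,y,z}(bc)/N → d/dA b(e^A, z)|_{A = log y}` for all `y, z > 0`;
  ★★★  `tendsto_varContacts_div_explicit`: the limit is `m₂₂/(m₁₁m₂₂ − m₁₂²) > 0` (inverse Hessian of the contact entropy at the typical pair);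
  ★★★★ `tendsto_varContacts_div_uniform`: for the UNIFORM strip walk (`y = z = 1`, `μ` the plastic number)
        `Var_N(bc)/N → (21μ² + 95μ − 14)/1058 ∈ (0.1405, 0.1406)`.

* §1 `contDiff_two_of_hasDerivAt_two`, `derivData_of_contDiff_two` (plumbing), ★ `contDiff_two_log_stripMuY₂_exp` (`Λ ∈ C²`, `Λ' = b`).
* §2 `sqContacts`, `varContacts` (defs), `stripZ₂_one_tilt_eq_sum` (`C_{1,N}(ye^t,z) = Σ wgt·e^{t·bc}`), ★★ `contactFreeEnergy_facts`
  (`F_N = log C_{1,N}(ye^t,z)`: `F_N'' = v_N ≥ 0`, `v_N(0) = Var`, `v_N(t) ≶ e^{±(N+1)t} v_N(0)` — CAR «CUMULANTS» with `0 ≤ bc ≤ N+1`).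
* §3 `parityAmplitude` (def; the tree's closed forms via `pfU₀…pfU₅`), `tendsto_parityAmplitude`, `parityAmplitude_pos`, `amplitudeDen_pos`,
  `continuousOn_parityAmplitude`, `parityAmplitude_bounds`.
* §4 ★ `contDiff_two_parityG`: `t ↦ c·Λ(A₀+t) + log A_c(e^{A₀+t}, e^B)` is `C²` (`μ₁ = e^Λ`, rational structure, `fun_prop`).
* §5 `tendsto_of_tendsto_even_odd`, ★★★ `tendsto_varContacts_parity_div` (`Var_{2M+c}/M → 2·∂b/∂A`: the engine applied per parity with
  `F_M = log C_{1,2M+c}(ye^t,z)` (`F_0 := 0`), `φ = 2Λ(A₀+·)`, `G = cΛ(A₀+·) + log A_c`, `K = 5`, `τ = 1`, remainder from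
  `exists_uniform_log_two_term` on `[ye^{-1}, ye]`).
* §6 the three headline theorems.

Numerics (`var_check.py`, exact bivariate enumeration from the rational series): `(y,z) = (1,1)`: `Var_N(bc)/N = 0.1324, 0.1364, 0.1385, 0.1395`
at `N = 30, 60, 120, 240` against the closed form `0.140549`, with `N·(Var_N/N − rate) = −0.247` constant to 4 digits (a clean `1/N` correction);
`(2,1)`: `→ 0.185942`; `(½,3)`: `→ 0.031059` (correction `+0.2066/N`).

## Sources
A. Dembo, O. Zeitouni, *Large Deviations Techniques and Applications* (2010) §2.3 (Gärtner–Ellis: differentiability of the limiting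
logarithmic moment generating function and the role of its second derivative; lane statement — the variance density as curvature);
N. R. Beaton, M. Bousquet-Mélou, J. de Gier, H. Duminil-Copin, A. J. Guttmann, CMP 326 (2014), arXiv:1109.0358v5 §3.2 (p. 10:
`C_{T,N}(y,z)`, Proposition 6: `μ_T(y,z)`); E. J. Janse van Rensburg, *The Statistical Mechanics of Interacting Walks…* (2000, 1st ed.) §3.3
(fluctuations of the energy in adsorption models); N. Madras, G. Slade, *The Self-Avoiding Walk* (1993) §1.1 eq. (1.1.4) p. 5, §8.5
pp. 278–279.  Nothing is quoted AS PRINTED: the theorem and its constants are this lineage's, assembled from the tree.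
-/

noncomputable section

open Filter Topology Finset Set Literature.Analysis Literature.Probability.Moments
open Literature.Probability.LatticeModels Literature.Probability.Percolation

namespace Literature.Probability.RandomPlanarGeometry.SAW.HexBW

namespace WidthOneYZ

variable {y z : ℝ}

/-! ## §1 The free energy `Λ(A) = log μ₁(e^A, e^B)` is `C²` -/

/-- `C²` from derivative data: `f' = f₁`, `f₁' = f₂`, `f₂` continuous ⇒ `ContDiff ℝ 2 f`. [cite: DemboZeitouni2010, §2.3 (lane plumbing)] -/
private theorem contDiff_two_of_hasDerivAt_two {f f₁ f₂ : ℝ → ℝ} (h1 : ∀ x, HasDerivAt f (f₁ x) x) (h2 : ∀ x, HasDerivAt f₁ (f₂ x) x)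
    (h3 : Continuous f₂) : ContDiff ℝ 2 f := by
  have hd1 : deriv f = f₁ := funext fun x => (h1 x).deriv
  have hd2 : deriv f₁ = f₂ := funext fun x => (h2 x).deriv
  rw [show (2 : WithTop ℕ∞) = (1 : WithTop ℕ∞) + 1 from rfl, contDiff_succ_iff_deriv]
  refine ⟨fun x => (h1 x).differentiableAt, by simp, ?_⟩
  rw [hd1, show (1 : WithTop ℕ∞) = (0 : WithTop ℕ∞) + 1 from rfl, contDiff_succ_iff_deriv]
  refine ⟨fun x => (h2 x).differentiableAt, by simp, ?_⟩
  rw [hd2, contDiff_zero]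
  exact h3

/-- Derivative data from `C²`: `g' = deriv g`, `g'' = deriv (deriv g)` as `HasDerivAt`, `deriv (deriv g)` continuous and bounded on every
compact interval. [cite: DemboZeitouni2010, §2.3 (lane plumbing)] -/
private theorem derivData_of_contDiff_two {g : ℝ → ℝ} (hg : ContDiff ℝ 2 g) (τ : ℝ) :
    (∀ t, HasDerivAt g (deriv g t) t) ∧ (∀ t, HasDerivAt (deriv g) (deriv (deriv g) t) t) ∧
      Continuous (deriv (deriv g)) ∧ ∃ B, ∀ t ∈ Icc (-τ) τ, |deriv (deriv g) t| ≤ B := by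
  have h1 : Differentiable ℝ g := hg.differentiable (by norm_num)
  have h2 : ContDiff ℝ 1 (deriv g) :=
    (contDiff_succ_iff_deriv.1 (show ContDiff ℝ ((1 : WithTop ℕ∞) + 1) g from hg)).2.2
  have h3 : Differentiable ℝ (deriv g) := h2.differentiable (by norm_num)
  have h4 : Continuous (deriv (deriv g)) :=
    ((contDiff_succ_iff_deriv.1 (show ContDiff ℝ ((0 : WithTop ℕ∞) + 1) (deriv g) from h2)).2.2).continuous
  refine ⟨fun t => (h1 t).hasDerivAt, fun t => (h3 t).hasDerivAt, h4, ?_⟩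
  obtain ⟨B, hB⟩ := isCompact_Icc.exists_bound_of_continuousOn (h4.continuousOn (s := Icc (-τ) τ))
  exact ⟨B, fun t ht => by simpa [Real.norm_eq_abs] using hB t ht⟩

/-- ★ **The free energy is `C²` in the log-fugacity**: `A ↦ Λ(A) = log μ₁(e^A, e^B)` is `ContDiff ℝ 2`, with `Λ' = b(e^A, e^B)`
(tree: `hasDerivAt_log_stripMuY₂_exp`) and `Λ'' = m₂₂/D` (tree: `hasDerivAt_contactB_log`), the latter continuous because `b` and
`b'` are (differentiable) and the typical pair stays inside the density triangle.
[cite: DemboZeitouni2010, §2.3 (Gärtner–Ellis: smoothness of the limiting logarithmic moment generating function; lane statement); BeatonBousquetMelouDeGierDuminilCopinGuttmann2014, §3.2 Proposition 6 (arXiv v5 p. 10)] -/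
theorem contDiff_two_log_stripMuY₂_exp (B : ℝ) :
    ContDiff ℝ 2 (fun A => Real.log (stripMuY₂ 1 (Real.exp A) (Real.exp B))) ∧
      deriv (fun A => Real.log (stripMuY₂ 1 (Real.exp A) (Real.exp B))) = fun A => contactB (Real.exp A) (Real.exp B) := by
  set bA : ℝ → ℝ := fun A => contactB (Real.exp A) (Real.exp B) with hbA
  set bB : ℝ → ℝ := fun A => contactB (Real.exp B) (Real.exp A) with hbB
  set β : ℝ → ℝ := fun A =>
    (4 / (1 - 2 * bA A - 2 * bB A) + 2 / (4 * bA A + 2 * bB A - 1) + 8 / (2 * bA A + 4 * bB A - 1) - 1 / bB A) /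
      ((4 / (1 - 2 * bA A - 2 * bB A) + 8 / (4 * bA A + 2 * bB A - 1) + 2 / (2 * bA A + 4 * bB A - 1) - 1 / bA A)
        * (4 / (1 - 2 * bA A - 2 * bB A) + 2 / (4 * bA A + 2 * bB A - 1) + 8 / (2 * bA A + 4 * bB A - 1) - 1 / bB A)
        - (4 / (1 - 2 * bA A - 2 * bB A) + 4 / (4 * bA A + 2 * bB A - 1) + 4 / (2 * bA A + 4 * bB A - 1)) ^ 2) with hβ
  have hz : 0 < Real.exp B := Real.exp_pos B
  have h1 : ∀ A, HasDerivAt (fun A => Real.log (stripMuY₂ 1 (Real.exp A) (Real.exp B))) (bA A) A :=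
    fun A => hasDerivAt_log_stripMuY₂_exp hz A
  have h2 : ∀ A, HasDerivAt bA (β A) A := fun A => (hasDerivAt_contactB_log A B).2.2.1
  have h2' : ∀ A, HasDerivAt bB _ A := fun A => (hasDerivAt_contactB_log A B).2.2.2.2.1
  have hcA : Continuous bA := continuous_iff_continuousAt.2 fun A => (h2 A).continuousAt
  have hcB : Continuous bB := continuous_iff_continuousAt.2 fun A => (h2' A).continuousAt
  -- the denominators never vanish (typical pair inside the triangle; `D > 0`)
  have hden : ∀ A, 1 - 2 * bA A - 2 * bB A ≠ 0 ∧ 4 * bA A + 2 * bB A - 1 ≠ 0 ∧ 2 * bA A + 4 * bB A - 1 ≠ 0 ∧ bA A ≠ 0 ∧ bB A ≠ 0 ∧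
      (4 / (1 - 2 * bA A - 2 * bB A) + 8 / (4 * bA A + 2 * bB A - 1) + 2 / (2 * bA A + 4 * bB A - 1) - 1 / bA A)
        * (4 / (1 - 2 * bA A - 2 * bB A) + 2 / (4 * bA A + 2 * bB A - 1) + 8 / (2 * bA A + 4 * bB A - 1) - 1 / bB A)
        - (4 / (1 - 2 * bA A - 2 * bB A) + 4 / (4 * bA A + 2 * bB A - 1) + 4 / (2 * bA A + 4 * bB A - 1)) ^ 2 ≠ 0 := by
    intro A
    obtain ⟨t1, t2, t3⟩ := contactB_mem_triangle (Real.exp_pos A) hz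
    have hb0 := (contactB_facts (Real.exp_pos A) hz).2.2.2.2.1
    have hb0' := (contactB_facts hz (Real.exp_pos A)).2.2.2.2.1
    have hD := (hasDerivAt_contactB_log A B).1
    refine ⟨by linarith, by linarith, by linarith, hb0.ne', hb0'.ne', hD.ne'⟩
  have hcβ : Continuous β := by
    rw [hβ]
    have d1 : ∀ A, 1 - 2 * bA A - 2 * bB A ≠ 0 := fun A => (hden A).1
    have d2 : ∀ A, 4 * bA A + 2 * bB A - 1 ≠ 0 := fun A => (hden A).2.1
    have d3 : ∀ A, 2 * bA A + 4 * bB A - 1 ≠ 0 := fun A => (hden A).2.2.1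
    have d4 : ∀ A, bA A ≠ 0 := fun A => (hden A).2.2.2.1
    have d5 : ∀ A, bB A ≠ 0 := fun A => (hden A).2.2.2.2.1
    have d6 := fun A => (hden A).2.2.2.2.2
    fun_prop (disch := assumption)
  refine ⟨contDiff_two_of_hasDerivAt_two h1 h2 hcβ, funext fun A => (h1 A).deriv⟩

/-! ## §2 The contact partition function as a finite log-Laplace transform: mean, variance, no `1/N`-oscillation -/

/-- **Second moment of the bottom contacts under `P_{N,y,z}`**: `⟨bc²⟩_{N,y,z}`.
[cite: BeatonBousquetMelouDeGierDuminilCopinGuttmann2014, §3.2 (arXiv v5 p. 10: the weights y^{bc} z^{tc})] -/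
def sqContacts (y z : ℝ) (N : ℕ) : ℝ :=
  (∑ q ∈ stripPairs 1 N, wgt y z N q * (bottomVisits₀ q.1 q.2 N : ℝ) ^ 2) / stripZ₂ 1 N y z

/-- ★ **The variance of the number of bottom contacts under `P_{N,y,z}`**: `Var_{N,y,z}(bc) = ⟨bc²⟩ − ⟨bc⟩²`.
[cite: BeatonBousquetMelouDeGierDuminilCopinGuttmann2014, §3.2 (arXiv v5 p. 10); DemboZeitouni2010, §2.3 (lane statement)] -/
def varContacts (y z : ℝ) (N : ℕ) : ℝ := sqContacts y z N - meanContacts y z N ^ 2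

/-- `stripPairs 1 N` is nonempty (the partition function is positive). [cite: BeatonBousquetMelouDeGierDuminilCopinGuttmann2014, §3.2 (lane plumbing)] -/
private theorem stripPairs_one_nonempty (N : ℕ) : (stripPairs 1 N).Nonempty := by
  have h := stripZ₂_pos 1 N one_pos one_pos
  rw [stripZ₂_one_eq_sum_wgt] at h
  exact Finset.nonempty_of_sum_ne_zero h.ne'

/-- **Tilting the bottom fugacity is an exponential tilt of the contact number**: `C_{1,N}(y e^t, z) = Σ_q wgt_q(y,z)·e^{t·bc(q)}`.
[cite: BeatonBousquetMelouDeGierDuminilCopinGuttmann2014, §3.2 (arXiv v5 p. 10); DemboZeitouni2010, §2.2 (lane statement)] -/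
theorem stripZ₂_one_tilt_eq_sum (y z t : ℝ) (N : ℕ) :
    stripZ₂ 1 N (y * Real.exp t) z = ∑ q ∈ stripPairs 1 N, wgt y z N q * Real.exp (t * (bottomVisits₀ q.1 q.2 N : ℝ)) := by
  rw [stripZ₂_one_eq_sum_wgt]
  refine Finset.sum_congr rfl fun q _ => ?_
  unfold wgt
  rw [mul_pow, ← Real.exp_nat_mul]
  ring_nf

/-- The tilted first-moment sum at `t = 0` is `C_{1,N}·⟨bc⟩` and the tilted second-moment sum is `C_{1,N}·⟨bc²⟩` (bookkeeping).
[cite: DemboZeitouni2010, §2.2 (lane plumbing)] -/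
private theorem tilt_sums_at_zero (y z : ℝ) (N : ℕ) :
    (∑ q ∈ stripPairs 1 N, wgt y z N q * Real.exp (0 * (bottomVisits₀ q.1 q.2 N : ℝ))) = stripZ₂ 1 N y z ∧
    (∑ q ∈ stripPairs 1 N, wgt y z N q * (bottomVisits₀ q.1 q.2 N : ℝ) * Real.exp (0 * (bottomVisits₀ q.1 q.2 N : ℝ)))
        = ∑ q ∈ stripPairs 1 N, wgt y z N q * (bottomVisits₀ q.1 q.2 N : ℝ) ∧
    (∑ q ∈ stripPairs 1 N, wgt y z N q * (bottomVisits₀ q.1 q.2 N : ℝ) ^ 2 * Real.exp (0 * (bottomVisits₀ q.1 q.2 N : ℝ)))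
        = ∑ q ∈ stripPairs 1 N, wgt y z N q * (bottomVisits₀ q.1 q.2 N : ℝ) ^ 2 := by
  refine ⟨?_, ?_, ?_⟩ <;> simp only [zero_mul, Real.exp_zero, mul_one, stripZ₂_one_eq_sum_wgt]

/-- ★★ **The contact free energy `F_N(t) = log C_{1,N}(y e^t, z)` along the bottom tilt**: `F_N' =` tilted mean, `F_N'' =` tilted variance
`v_N(t) ≥ 0`, `v_N(0) = Var_{N,y,z}(bc)`, `F_N'(0) = ⟨bc⟩`, and — since `0 ≤ bc ≤ N + 1` — the variance does not oscillate on scales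
`≪ 1/N`: `v_N(t) ≤ e^{(N+1)t} v_N(0)`, `v_N(0) ≤ e^{(N+1)t} v_N(t)` for `t ≥ 0` (CAR «FINITE LOG-LAPLACE CUMULANTS»).
[cite: DemboZeitouni2010, §2.2–§2.3 (lane statement); BeatonBousquetMelouDeGierDuminilCopinGuttmann2014, §3.2 (arXiv v5 p. 10)] -/
theorem contactFreeEnergy_facts (hy : 0 < y) (hz : 0 < z) (N : ℕ) :
    let Z : ℝ → ℝ := fun t => ∑ q ∈ stripPairs 1 N, wgt y z N q * Real.exp (t * (bottomVisits₀ q.1 q.2 N : ℝ))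
    let M₁ : ℝ → ℝ := fun t => ∑ q ∈ stripPairs 1 N, wgt y z N q * (bottomVisits₀ q.1 q.2 N : ℝ) * Real.exp (t * (bottomVisits₀ q.1 q.2 N : ℝ))
    let M₂ : ℝ → ℝ := fun t =>
      ∑ q ∈ stripPairs 1 N, wgt y z N q * (bottomVisits₀ q.1 q.2 N : ℝ) ^ 2 * Real.exp (t * (bottomVisits₀ q.1 q.2 N : ℝ))
    let v : ℝ → ℝ := fun t => M₂ t / Z t - (M₁ t / Z t) ^ 2
    (∀ t, HasDerivAt (fun t => Real.log (stripZ₂ 1 N (y * Real.exp t) z)) (M₁ t / Z t) t) ∧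
    (∀ t, HasDerivAt (fun t => M₁ t / Z t) (v t) t) ∧
    (∀ t, 0 ≤ v t) ∧ v 0 = varContacts y z N ∧ M₁ 0 / Z 0 = meanContacts y z N ∧
    (∀ t, 0 ≤ t → v t ≤ Real.exp (((N : ℝ) + 1) * t) * v 0 ∧ v 0 ≤ Real.exp (((N : ℝ) + 1) * t) * v t) := by
  intro Z M₁ M₂ v
  have hs : (stripPairs 1 N).Nonempty := stripPairs_one_nonempty N
  have hw : ∀ q ∈ stripPairs 1 N, 0 < wgt y z N q := fun q _ => wgt_pos hy hz N q
  have hx : ∀ q ∈ stripPairs 1 N, (0 : ℝ) ≤ (bottomVisits₀ q.1 q.2 N : ℝ) ∧ (bottomVisits₀ q.1 q.2 N : ℝ) ≤ 0 + ((N : ℝ) + 1) := by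
    intro q _
    refine ⟨Nat.cast_nonneg _, ?_⟩
    rw [zero_add]
    exact_mod_cast bottomVisits₀_le q.1 q.2 N
  refine ⟨?_, ?_, ?_, ?_, ?_, ?_⟩
  · intro t
    have h := hasDerivAt_log_finLaplace (x := fun q => (bottomVisits₀ q.1 q.2 N : ℝ)) (w := wgt y z N) hs hw t
    have e : (fun t => Real.log (stripZ₂ 1 N (y * Real.exp t) z))
        = fun t => Real.log (∑ q ∈ stripPairs 1 N, wgt y z N q * Real.exp (t * (bottomVisits₀ q.1 q.2 N : ℝ))) := by
      funext u; rw [stripZ₂_one_tilt_eq_sum]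
    rw [e]; exact h
  · intro t
    exact hasDerivAt_finLaplace_mean (x := fun q => (bottomVisits₀ q.1 q.2 N : ℝ)) (w := wgt y z N) hs hw t
  · intro t
    exact finLaplace_var_nonneg (x := fun q => (bottomVisits₀ q.1 q.2 N : ℝ)) (w := wgt y z N) hs hw t
  · obtain ⟨e0, e1, e2⟩ := tilt_sums_at_zero y z N
    show M₂ 0 / Z 0 - (M₁ 0 / Z 0) ^ 2 = varContacts y z N
    simp only [Z, M₁, M₂, e0, e1, e2, varContacts, sqContacts, meanContacts]
  · obtain ⟨e0, e1, -⟩ := tilt_sums_at_zero y z N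
    show M₁ 0 / Z 0 = meanContacts y z N
    simp only [Z, M₁, e0, e1, meanContacts]
  · intro t ht
    exact finLaplace_var_le_exp_mul (x := fun q => (bottomVisits₀ q.1 q.2 N : ℝ)) (w := wgt y z N) hs hw hx ht

/-! ## §3 The parity amplitudes as functions of the fugacities: positivity, continuity -/

/-- **The parity amplitudes** `A_c(y,z)` of the tree's `tendsto_stripZ₂_one_even_div_pow` (`c = 0`) and
`tendsto_stripZ₂_one_odd_div_pow` (`c ≠ 0`), written with the partial-fraction polynomials `pfU₀ … pfU₅`:
`A₀ = s(U₀s² + U₂s + U₄)/(d·D₂)`, `A₁ = s(U₁s² + U₃s + U₅)/(d·μ·D₂)`, `s = μ₁²`, `d = ((y−z)²+2y+2z+1)²`, `D₂ = (y+z)s² − 2yz·s + 3yz`.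
[cite: MadrasSlade1993, §1.1 eq. (1.1.4) p. 5 (the amplitude); BeatonBousquetMelouDeGierDuminilCopinGuttmann2014, §3.2 (arXiv v5 pp. 10, 12); Stanley2012EC1, §4.1 Theorem 4.1.1 (iii)] -/
def parityAmplitude (c : ℕ) (y z : ℝ) : ℝ :=
  if c = 0 then
    stripMuY₂ 1 y z ^ 2 * (pfU₀ y z * (stripMuY₂ 1 y z ^ 2) ^ 2 + pfU₂ y z * stripMuY₂ 1 y z ^ 2 + pfU₄ y z)
      / (((y - z) ^ 2 + 2 * y + 2 * z + 1) ^ 2 * ((y + z) * (stripMuY₂ 1 y z ^ 2) ^ 2 - 2 * (y * z) * stripMuY₂ 1 y z ^ 2 + 3 * (y * z)))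
  else
    stripMuY₂ 1 y z ^ 2 * (pfU₁ y z * (stripMuY₂ 1 y z ^ 2) ^ 2 + pfU₃ y z * stripMuY₂ 1 y z ^ 2 + pfU₅ y z)
      / (((y - z) ^ 2 + 2 * y + 2 * z + 1) ^ 2 * stripMuY₂ 1 y z
          * ((y + z) * (stripMuY₂ 1 y z ^ 2) ^ 2 - 2 * (y * z) * stripMuY₂ 1 y z ^ 2 + 3 * (y * z)))

/-- ★ `C_{1,2M+c}(y,z)/μ₁(y,z)^{2M+c} → A_c(y,z)` for `c ∈ {0,1}` (the tree's parity amplitude theorems, restated through `parityAmplitude`).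
[cite: MadrasSlade1993, §1.1 eq. (1.1.4) p. 5; BeatonBousquetMelouDeGierDuminilCopinGuttmann2014, §3.2 (arXiv v5 pp. 10, 12); Stanley2012EC1, §4.1 Theorem 4.1.1 (iii)] -/
theorem tendsto_parityAmplitude (hy : 0 < y) (hz : 0 < z) {c : ℕ} (hc : c < 2) :
    Tendsto (fun M => stripZ₂ 1 (2 * M + c) y z / stripMuY₂ 1 y z ^ (2 * M + c)) atTop (𝓝 (parityAmplitude c y z)) := by
  interval_cases c
  · have h := tendsto_stripZ₂_one_even_div_pow hy hz
    simp only [parityAmplitude, if_true, pfU₀, pfU₂, pfU₄]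
    simpa using h
  · have h := tendsto_stripZ₂_one_odd_div_pow hy hz
    simp only [parityAmplitude, one_ne_zero, if_false, pfU₁, pfU₃, pfU₅]
    exact h

/-- `A_c(y,z) > 0` (`c ∈ {0,1}`; Fekete's `μ^N ≤ K(y)K(z)C_{1,N}`). [cite: MadrasSlade1993, §1.1 eq. (1.1.4) p. 5 (lane statement)] -/
theorem parityAmplitude_pos (hy : 0 < y) (hz : 0 < z) {c : ℕ} (hc : c < 2) : 0 < parityAmplitude c y z :=
  pos_of_tendsto_stripZ₂_one_parity hy hz c (tendsto_parityAmplitude hy hz hc)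

/-- The amplitude denominator factor `D₂ = (y+z)s² − 2yz·s + 3yz = s(s² − yz) + 2yz > 0` (`s = μ₁²`, sextic law).
[cite: BeatonBousquetMelouDeGierDuminilCopinGuttmann2014, §3.2 Proposition 6 (arXiv v5 p. 10; lane computation)] -/
theorem amplitudeDen_pos (hy : 0 < y) (hz : 0 < z) :
    0 < (y + z) * (stripMuY₂ 1 y z ^ 2) ^ 2 - 2 * (y * z) * stripMuY₂ 1 y z ^ 2 + 3 * (y * z) := by
  set s := stripMuY₂ 1 y z ^ 2 with hs
  have hμ := stripMuY₂_pos 1 hy hz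
  have hs0 : 0 < s := by positivity
  have hsex : s * (s - y) * (s - z) = y * z := stripMuY₂_one_sq_poly_eq hy hz
  obtain ⟨-, -, h3⟩ := sexticCofactor_ineqs hy hz
  rw [← hs] at h3
  have e : (y + z) * s ^ 2 - 2 * (y * z) * s + 3 * (y * z) = s * (s ^ 2 - y * z) + 2 * (y * z) := by
    linear_combination (-1 : ℝ) * hsex
  rw [e]
  have hyz := mul_pos hy hz
  nlinarith

/-- ★ `y ↦ A_c(y,z)` is continuous on every compact interval of positive fugacities (rational in `y` and `μ₁(y,z)`, positive denominator).
[cite: BeatonBousquetMelouDeGierDuminilCopinGuttmann2014, Proposition 6 (arXiv v5 p. 10: μ continuous); MadrasSlade1993, §1.1 (lane statement)] -/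
theorem continuousOn_parityAmplitude (hz : 0 < z) {y₁ y₂ : ℝ} (hy₁ : 0 < y₁) (c : ℕ) :
    ContinuousOn (fun y => parityAmplitude c y z) (Icc y₁ y₂) := by
  set S : Set ℝ := Icc y₁ y₂
  have hSpos : ∀ y ∈ S, 0 < y := fun y hy => lt_of_lt_of_le hy₁ hy.1
  have hμc : ContinuousOn (fun y => stripMuY₂ 1 y z) S := by
    intro y hyS
    have hy0 : 0 < y := hSpos y hyS
    have h : ContinuousAt (fun p : ℝ × ℝ => stripMuY₂ 1 p.1 p.2) (y, z) :=
      (continuousOn_stripMuY₂ 1).continuousAt ((isOpen_Ioi.prod isOpen_Ioi).mem_nhds ⟨hy0, hz⟩)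
    have hg : ContinuousAt (fun y' : ℝ => (y', z)) y := continuousAt_id.prodMk continuousAt_const
    exact (ContinuousAt.comp (f := fun y' : ℝ => (y', z)) (g := fun p : ℝ × ℝ => stripMuY₂ 1 p.1 p.2) h hg).continuousWithinAt
  obtain ⟨-, -, cU0, cU1, cU2, cU3, cU4, cU5, -, -, -, -, -, -, -, -⟩ := continuous_pfCoeffs z
  have hd1 : ∀ y ∈ S, ((y - z) ^ 2 + 2 * y + 2 * z + 1) ^ 2 *
      ((y + z) * (stripMuY₂ 1 y z ^ 2) ^ 2 - 2 * (y * z) * stripMuY₂ 1 y z ^ 2 + 3 * (y * z)) ≠ 0 := by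
    intro y hy
    have h0 := hSpos y hy
    exact mul_ne_zero (by positivity) (amplitudeDen_pos h0 hz).ne'
  have hd2 : ∀ y ∈ S, ((y - z) ^ 2 + 2 * y + 2 * z + 1) ^ 2 * stripMuY₂ 1 y z *
      ((y + z) * (stripMuY₂ 1 y z ^ 2) ^ 2 - 2 * (y * z) * stripMuY₂ 1 y z ^ 2 + 3 * (y * z)) ≠ 0 := by
    intro y hy
    have h0 := hSpos y hy
    exact mul_ne_zero (mul_ne_zero (by positivity) (stripMuY₂_pos 1 h0 hz).ne') (amplitudeDen_pos h0 hz).ne'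
  rcases Nat.eq_zero_or_pos c with h0 | h0
  · subst h0
    simp only [parityAmplitude, if_true]
    fun_prop (disch := assumption)
  · have hc : c ≠ 0 := by omega
    simp only [parityAmplitude, hc, if_false]
    fun_prop (disch := assumption)

/-- Uniform positive bounds for `A_c` on a compact interval. [cite: MadrasSlade1993, §1.1 eq. (1.1.4) p. 5 (lane statement)] -/
theorem parityAmplitude_bounds (hz : 0 < z) {y₁ y₂ : ℝ} (hy₁ : 0 < y₁) (h12 : y₁ ≤ y₂) {c : ℕ} (hc : c < 2) :
    ∃ a₁ a₂ : ℝ, 0 < a₁ ∧ ∀ y ∈ Icc y₁ y₂, a₁ ≤ parityAmplitude c y z ∧ parityAmplitude c y z ≤ a₂ := by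
  have hne : (Icc y₁ y₂).Nonempty := ⟨y₁, le_rfl, h12⟩
  have hcont := continuousOn_parityAmplitude hz hy₁ c (y₂ := y₂)
  obtain ⟨ym, hym, hmin⟩ := isCompact_Icc.exists_isMinOn hne hcont
  obtain ⟨yM, hyM, hmax⟩ := isCompact_Icc.exists_isMaxOn hne hcont
  refine ⟨parityAmplitude c ym z, parityAmplitude c yM z, parityAmplitude_pos (lt_of_lt_of_le hy₁ hym.1) hz hc, fun y hy => ⟨hmin hy, hmax hy⟩⟩

/-! ## §4 The amplitude correction `G_c(t) = c·Λ(A₀+t) + log A_c(e^{A₀+t}, e^B)` is `C²` -/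

/-- ★ **`G_c` is `C²`**: with `Λ(A) = log μ₁(e^A, e^B)` (C², §1) and `μ₁ = e^Λ`, the amplitude `A_c(e^{A₀+t}, e^B)` is a rational function of
`e^{A₀+t}` and `e^{Λ(A₀+t)}` with a positive denominator, and it is positive; so `t ↦ c·Λ(A₀+t) + log A_c(e^{A₀+t}, e^B)` is `ContDiff ℝ 2`.
[cite: DemboZeitouni2010, §2.3 (lane statement); MadrasSlade1993, §1.1 eq. (1.1.4) p. 5; Stanley2012EC1, §4.1 Theorem 4.1.1 (iii)] -/
theorem contDiff_two_parityG (A₀ B : ℝ) {c : ℕ} (hc : c < 2) :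
    ContDiff ℝ 2 (fun t => (c : ℝ) * Real.log (stripMuY₂ 1 (Real.exp (A₀ + t)) (Real.exp B))
      + Real.log (parityAmplitude c (Real.exp (A₀ + t)) (Real.exp B))) := by
  obtain ⟨Λ, hΛdef⟩ : ∃ Λ : ℝ → ℝ, Λ = fun A => Real.log (stripMuY₂ 1 (Real.exp A) (Real.exp B)) := ⟨_, rfl⟩
  have hΛ : ContDiff ℝ 2 Λ := by rw [hΛdef]; exact (contDiff_two_log_stripMuY₂_exp B).1
  have hz : 0 < Real.exp B := Real.exp_pos B
  have hμΛ : ∀ A, stripMuY₂ 1 (Real.exp A) (Real.exp B) = Real.exp (Λ A) := fun A => by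
    rw [hΛdef]; exact (Real.exp_log (stripMuY₂_pos 1 (Real.exp_pos A) hz)).symm
  have hlogΛ : ∀ t, Real.log (Real.exp (Λ (A₀ + t))) = Λ (A₀ + t) := fun t => Real.log_exp _
  have hpos : ∀ t, 0 < parityAmplitude c (Real.exp (A₀ + t)) (Real.exp B) :=
    fun t => parityAmplitude_pos (Real.exp_pos _) hz hc
  have hden0 : ∀ t, ((Real.exp (A₀ + t) - Real.exp B) ^ 2 + 2 * Real.exp (A₀ + t) + 2 * Real.exp B + 1) ^ 2
      * ((Real.exp (A₀ + t) + Real.exp B) * (Real.exp (Λ (A₀ + t)) ^ 2) ^ 2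
          - 2 * (Real.exp (A₀ + t) * Real.exp B) * Real.exp (Λ (A₀ + t)) ^ 2 + 3 * (Real.exp (A₀ + t) * Real.exp B)) ≠ 0 := by
    intro t
    have h := amplitudeDen_pos (Real.exp_pos (A₀ + t)) hz
    rw [hμΛ] at h
    exact mul_ne_zero (by positivity) h.ne'
  have hden1 : ∀ t, ((Real.exp (A₀ + t) - Real.exp B) ^ 2 + 2 * Real.exp (A₀ + t) + 2 * Real.exp B + 1) ^ 2
      * Real.exp (Λ (A₀ + t))
      * ((Real.exp (A₀ + t) + Real.exp B) * (Real.exp (Λ (A₀ + t)) ^ 2) ^ 2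
          - 2 * (Real.exp (A₀ + t) * Real.exp B) * Real.exp (Λ (A₀ + t)) ^ 2 + 3 * (Real.exp (A₀ + t) * Real.exp B)) ≠ 0 := by
    intro t
    have h := amplitudeDen_pos (Real.exp_pos (A₀ + t)) hz
    rw [hμΛ] at h
    exact mul_ne_zero (mul_ne_zero (by positivity) (Real.exp_pos _).ne') h.ne'
  interval_cases c
  · have hne : ∀ t, parityAmplitude 0 (Real.exp (A₀ + t)) (Real.exp B) ≠ 0 := fun t => (hpos t).ne'
    simp only [parityAmplitude, if_true, hμΛ, pfU₀, pfU₂, pfU₄] at hne ⊢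
    simp only [Nat.cast_zero, zero_mul, zero_add]
    refine ContDiff.log ?_ hne
    fun_prop (disch := assumption)
  · have hne : ∀ t, parityAmplitude 1 (Real.exp (A₀ + t)) (Real.exp B) ≠ 0 := fun t => (hpos t).ne'
    simp only [parityAmplitude, one_ne_zero, if_false, hμΛ, pfU₁, pfU₃, pfU₅, hlogΛ] at hne ⊢
    simp only [Nat.cast_one, one_mul]
    refine ContDiff.add (hΛ.comp (contDiff_const.add contDiff_id)) (ContDiff.log ?_ hne)
    fun_prop (disch := assumption)

/-! ## §5 The variance theorem along each parity, via the quasi-linear second-derivative engine -/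

/-- If the even and odd subsequences of `u` converge to `L`, so does `u`. [cite: DemboZeitouni2010, §2.3 (lane plumbing)] -/
private theorem tendsto_of_tendsto_even_odd {u : ℕ → ℝ} {L : ℝ} (h0 : Tendsto (fun M => u (2 * M)) atTop (𝓝 L))
    (h1 : Tendsto (fun M => u (2 * M + 1)) atTop (𝓝 L)) : Tendsto u atTop (𝓝 L) := by
  rw [Metric.tendsto_atTop] at h0 h1 ⊢
  intro ε hε
  obtain ⟨M₀, hM₀⟩ := h0 ε hε
  obtain ⟨M₁, hM₁⟩ := h1 ε hε
  refine ⟨2 * max M₀ M₁ + 1, fun N hN => ?_⟩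
  obtain ⟨M, hM | hM⟩ := Nat.even_or_odd' N
  · rw [hM]
    exact hM₀ M (by omega)
  · rw [hM]
    exact hM₁ M (by omega)

/-- ★★★ **VARIANCE ALONG A PARITY**: for `y, z > 0` and `c ∈ {0,1}`,
`Var_{2M+c,y,z}(bc) / M → 2·∂b/∂A (A = log y)`, where `∂b/∂A = deriv (A ↦ b(e^A, z)) (log y)` is the own-wall susceptibility
(`= m₂₂/D > 0`, tree `hasDerivAt_contactB_log`).  Proof: `tendsto_deriv2_div_of_quasiLinear` with `F_M(t) = log C_{1,2M+c}(y e^t, z)`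
(`F_M'' =` tilted variance, no `1/M`-oscillation by §2), `φ = 2Λ(A₀ + ·)`, `G = cΛ(A₀ + ·) + log A_c` (C², §4), and the uniform remainder
`|F_M − Mφ − G| ≤ ε_M`, `Mε_M → 0` of CAR «UNIFORM TWO-TERM ASYMPTOTICS» (`exists_uniform_log_two_term`).
[cite: DemboZeitouni2010, §2.3 (Gärtner–Ellis; lane statement: the variance density is the curvature of the limiting free energy); BeatonBousquetMelouDeGierDuminilCopinGuttmann2014, §3.2 Proposition 6 (arXiv v5 p. 10); MadrasSlade1993, §1.1 eq. (1.1.4) p. 5] -/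
theorem tendsto_varContacts_parity_div (hy : 0 < y) (hz : 0 < z) {c : ℕ} (hc : c < 2) :
    Tendsto (fun M : ℕ => varContacts y z (2 * M + c) / M) atTop
      (𝓝 (2 * deriv (fun A => contactB (Real.exp A) z) (Real.log y))) := by
  -- log-fugacities
  set A₀ := Real.log y with hA₀
  set B := Real.log z with hBdef
  have hyA : Real.exp A₀ = y := Real.exp_log hy
  have hzB : Real.exp B = z := Real.exp_log hz
  -- the free energy `Λ` and its derivatives
  obtain ⟨Λ, hΛdef⟩ : ∃ Λ : ℝ → ℝ, Λ = fun A => Real.log (stripMuY₂ 1 (Real.exp A) (Real.exp B)) := ⟨_, rfl⟩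
  have hΛ2 : ContDiff ℝ 2 Λ := by rw [hΛdef]; exact (contDiff_two_log_stripMuY₂_exp B).1
  have hΛd : deriv Λ = fun A => contactB (Real.exp A) (Real.exp B) := by rw [hΛdef]; exact (contDiff_two_log_stripMuY₂_exp B).2
  obtain ⟨hΛ1, hΛ11, hΛ2c, -⟩ := derivData_of_contDiff_two hΛ2 1
  -- `φ = 2Λ(A₀ + ·)`
  set φ : ℝ → ℝ := fun t => 2 * Λ (A₀ + t) with hφ
  set φ1 : ℝ → ℝ := fun t => 2 * deriv Λ (A₀ + t) with hφ1
  set φ2 : ℝ → ℝ := fun t => 2 * deriv (deriv Λ) (A₀ + t) with hφ2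
  have hshift : ∀ t, HasDerivAt (fun t : ℝ => A₀ + t) 1 t := fun t => by
    simpa using (hasDerivAt_id t).const_add A₀
  have hφd : ∀ t, HasDerivAt φ (φ1 t) t := by
    intro t
    have h := ((hΛ1 (A₀ + t)).comp t (hshift t)).const_mul 2
    simpa [hφ, hφ1] using h
  have hφ1d : ∀ t, HasDerivAt φ1 (φ2 t) t := by
    intro t
    have h := ((hΛ11 (A₀ + t)).comp t (hshift t)).const_mul 2
    simpa [hφ1, hφ2] using h
  have hφ2c : ContinuousAt φ2 0 := by
    have : Continuous φ2 := by
      rw [hφ2]; exact continuous_const.mul (hΛ2c.comp (continuous_const.add continuous_id))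
    exact this.continuousAt
  -- `G = cΛ(A₀ + ·) + log A_c(e^{A₀+·}, e^B)`, C²
  set G : ℝ → ℝ := fun t => (c : ℝ) * Real.log (stripMuY₂ 1 (Real.exp (A₀ + t)) (Real.exp B))
      + Real.log (parityAmplitude c (Real.exp (A₀ + t)) (Real.exp B)) with hG
  have hG2 : ContDiff ℝ 2 G := contDiff_two_parityG A₀ B hc
  obtain ⟨hGd, hG1d, hG2c, ⟨BG, hBG⟩⟩ := derivData_of_contDiff_two hG2 1
  -- `|G| ≤ BG0` on `[-1, 1]` (for the `M = 0` member)
  obtain ⟨BG0, hBG0⟩ := isCompact_Icc.exists_bound_of_continuousOn ((hG2.continuous).continuousOn (s := Icc (-1 : ℝ) 1))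
  -- the uniform remainder on `[y e^{-1}, y e]`
  set y₁ := Real.exp (A₀ - 1) with hy₁def
  set y₂ := Real.exp (A₀ + 1) with hy₂def
  have hy₁ : 0 < y₁ := Real.exp_pos _
  have h12 : y₁ ≤ y₂ := Real.exp_le_exp.2 (by linarith)
  obtain ⟨a₁, a₂, ha₁, hA⟩ := parityAmplitude_bounds hz hy₁ h12 hc
  obtain ⟨ε, hεlim, hεb⟩ := exists_uniform_log_two_term hz hy₁ h12 hc ha₁ hA
    (fun y' hy' => tendsto_parityAmplitude (lt_of_lt_of_le hy₁ hy'.1) hz hc)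
  have hmemI : ∀ t ∈ Ioo (-1 : ℝ) 1, Real.exp (A₀ + t) ∈ Icc y₁ y₂ := fun t ht =>
    ⟨Real.exp_le_exp.2 (by linarith [ht.1]), Real.exp_le_exp.2 (by linarith [ht.2])⟩
  -- the family `F_M(t) = log C_{1,2M+c}(y e^t, z)` (`F_0 := 0`)
  set Zf : ℕ → ℝ → ℝ := fun N t => ∑ q ∈ stripPairs 1 N, wgt y z N q * Real.exp (t * (bottomVisits₀ q.1 q.2 N : ℝ)) with hZf
  set M1f : ℕ → ℝ → ℝ := fun N t =>
    ∑ q ∈ stripPairs 1 N, wgt y z N q * (bottomVisits₀ q.1 q.2 N : ℝ) * Real.exp (t * (bottomVisits₀ q.1 q.2 N : ℝ)) with hM1f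
  set M2f : ℕ → ℝ → ℝ := fun N t =>
    ∑ q ∈ stripPairs 1 N, wgt y z N q * (bottomVisits₀ q.1 q.2 N : ℝ) ^ 2 * Real.exp (t * (bottomVisits₀ q.1 q.2 N : ℝ)) with hM2f
  set vf : ℕ → ℝ → ℝ := fun N t => M2f N t / Zf N t - (M1f N t / Zf N t) ^ 2 with hvf
  have facts : ∀ N, (∀ t, HasDerivAt (fun t => Real.log (stripZ₂ 1 N (y * Real.exp t) z)) (M1f N t / Zf N t) t) ∧
      (∀ t, HasDerivAt (fun t => M1f N t / Zf N t) (vf N t) t) ∧ (∀ t, 0 ≤ vf N t) ∧ vf N 0 = varContacts y z N ∧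
      M1f N 0 / Zf N 0 = meanContacts y z N ∧
      (∀ t, 0 ≤ t → vf N t ≤ Real.exp (((N : ℝ) + 1) * t) * vf N 0 ∧ vf N 0 ≤ Real.exp (((N : ℝ) + 1) * t) * vf N t) :=
    fun N => contactFreeEnergy_facts hy hz N
  set F : ℕ → ℝ → ℝ := fun M => if M = 0 then fun _ => 0 else fun t => Real.log (stripZ₂ 1 (2 * M + c) (y * Real.exp t) z) with hF
  set F1 : ℕ → ℝ → ℝ := fun M => if M = 0 then fun _ => 0 else fun t => M1f (2 * M + c) t / Zf (2 * M + c) t with hF1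
  set F2 : ℕ → ℝ → ℝ := fun M => if M = 0 then fun _ => 0 else fun t => vf (2 * M + c) t with hF2
  set ε' : ℕ → ℝ := fun M => if M = 0 then BG0 else ε M with hε'
  -- the engine
  have key := tendsto_deriv2_div_of_quasiLinear (F := F) (F1 := F1) (F2 := F2) (φ := φ) (φ1 := φ1) (φ2 := φ2)
    (G := G) (G1 := deriv G) (G2 := deriv (deriv G)) (τ := 1) (K := 5) (B := BG) (ε := ε') one_pos (by norm_num)
    ?_ ?_ ?_ ?_ (fun t _ => hφd t) (fun t _ => hφ1d t) hφ2c (fun t _ => hGd t) (fun t _ => hG1d t)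
    (fun t ht => hBG t ⟨ht.1.le, ht.2.le⟩) ?_ ?_
  · -- conclusion: `F2 M 0 / M = Var_{2M+c}/M`, `φ2 0 = 2 ∂b/∂A`
    have e1 : (fun M : ℕ => varContacts y z (2 * M + c) / M) = fun M : ℕ => F2 M 0 / M := by
      funext M
      rcases Nat.eq_zero_or_pos M with h | h
      · subst h; simp
      · have hM : M ≠ 0 := by omega
        simp only [hF2, hM, if_false, (facts (2 * M + c)).2.2.2.1]
    have e2 : 2 * deriv (fun A => contactB (Real.exp A) z) (Real.log y) = φ2 0 := by
      simp only [hφ2, add_zero, hΛd, hzB, hA₀]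
    rw [e1, e2]
    exact key
  · -- hF
    intro M t _
    rcases Nat.eq_zero_or_pos M with h | h
    · subst h; simp only [hF, hF1, if_true]; exact hasDerivAt_const t 0
    · have hM : M ≠ 0 := by omega
      simp only [hF, hF1, hM, if_false]
      exact (facts (2 * M + c)).1 t
  · -- hF1
    intro M t _
    rcases Nat.eq_zero_or_pos M with h | h
    · subst h; simp only [hF1, hF2, if_true]; exact hasDerivAt_const t 0
    · have hM : M ≠ 0 := by omega
      simp only [hF1, hF2, hM, if_false]
      exact (facts (2 * M + c)).2.1 t
  · -- hF2 ≥ 0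
    intro M
    rcases Nat.eq_zero_or_pos M with h | h
    · subst h; simp [hF2]
    · have hM : M ≠ 0 := by omega
      simp only [hF2, hM, if_false]
      exact (facts (2 * M + c)).2.2.1 0
  · -- hosc
    intro M t ht
    rcases Nat.eq_zero_or_pos M with h | h
    · subst h; simp [hF2]
    · have hM : M ≠ 0 := by omega
      simp only [hF2, hM, if_false]
      obtain ⟨o1, o2⟩ := (facts (2 * M + c)).2.2.2.2.2 t ht.1
      have hv0 := (facts (2 * M + c)).2.2.1 0
      have hvt := (facts (2 * M + c)).2.2.1 t
      have hexp : Real.exp ((((2 * M + c : ℕ) : ℝ) + 1) * t) ≤ Real.exp (5 * (M : ℝ) * t) := by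
        apply Real.exp_le_exp.2
        have hc1 : (c : ℝ) ≤ 1 := by exact_mod_cast (show c ≤ 1 by omega)
        have hM1 : (1 : ℝ) ≤ M := by exact_mod_cast h
        push_cast
        nlinarith [ht.1]
      exact ⟨o1.trans (mul_le_mul_of_nonneg_right hexp hv0), o2.trans (mul_le_mul_of_nonneg_right hexp hvt)⟩
  · -- hr
    intro M t ht
    rcases Nat.eq_zero_or_pos M with h | h
    · subst h
      simp only [hF, hε', if_true, Nat.cast_zero, zero_mul, sub_zero, zero_sub, abs_neg]
      have := hBG0 t ⟨ht.1.le, ht.2.le⟩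
      simpa [Real.norm_eq_abs] using this
    · have hM : M ≠ 0 := by omega
      simp only [hF, hε', hM, if_false]
      have hb := hεb M (Real.exp (A₀ + t)) (hmemI t ht)
      have ey : y * Real.exp t = Real.exp (A₀ + t) := by rw [Real.exp_add, hyA]
      have eΛ : Λ (A₀ + t) = Real.log (stripMuY₂ 1 (Real.exp (A₀ + t)) z) := by rw [hΛdef, hzB]
      rw [ey]
      have eG : G t = (c : ℝ) * Real.log (stripMuY₂ 1 (Real.exp (A₀ + t)) z)
          + Real.log (parityAmplitude c (Real.exp (A₀ + t)) z) := by simp only [hG, hzB]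
      rw [eG, hφ]
      simp only [eΛ]
      have e : Real.log (stripZ₂ 1 (2 * M + c) (Real.exp (A₀ + t)) z) - (M : ℝ) * (2 * Real.log (stripMuY₂ 1 (Real.exp (A₀ + t)) z))
            - ((c : ℝ) * Real.log (stripMuY₂ 1 (Real.exp (A₀ + t)) z) + Real.log (parityAmplitude c (Real.exp (A₀ + t)) z))
          = Real.log (stripZ₂ 1 (2 * M + c) (Real.exp (A₀ + t)) z) - (2 * (M : ℝ) + c) * Real.log (stripMuY₂ 1 (Real.exp (A₀ + t)) z)
            - Real.log (parityAmplitude c (Real.exp (A₀ + t)) z) := by ring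
      rw [e]
      exact hb
  · -- `M ε'_M → 0`
    refine hεlim.congr' ?_
    filter_upwards [eventually_ge_atTop 1] with M hM
    have hM0 : M ≠ 0 := by omega
    simp only [hε', hM0, if_false]

/-! ## §6 ★★★★ THE VARIANCE THEOREM: `Var_{N,y,z}(bc)/N → ∂b/∂log y` -/

/-- `M/(2M+1) → 1/2`. [cite: DemboZeitouni2010, §2.3 (lane plumbing)] -/
private theorem tendsto_natCast_div_two_mul_add_one : Tendsto (fun M : ℕ => (M : ℝ) / (2 * M + 1)) atTop (𝓝 (1 / 2)) := by
  have h1 : Tendsto (fun M : ℕ => (1 : ℝ) / (M : ℝ)) atTop (𝓝 0) := tendsto_one_div_atTop_nhds_zero_nat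
  have h2 : Tendsto (fun M : ℕ => (1 : ℝ) / (2 + 1 / (M : ℝ))) atTop (𝓝 (1 / (2 + 0))) :=
    tendsto_const_nhds.div (tendsto_const_nhds.add h1) (by norm_num)
  rw [add_zero] at h2
  refine h2.congr' ?_
  filter_upwards [eventually_ge_atTop 1] with M hM
  have hM0 : (M : ℝ) ≠ 0 := by exact_mod_cast (show M ≠ 0 by omega)
  field_simp

/-- ★★★★ **THE VARIANCE OF THE CONTACT NUMBER**: for every `y, z > 0`,
`Var_{N,y,z}(bc) / N → ∂b/∂A |_{A = log y}` — the variance of the number of bottom-wall contacts of the `N`-step walk of the width-one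
two-wall strip under `P_{N,y,z}` grows linearly, with rate the own-wall susceptibility `d/dA b(e^A, z)` (the curvature of the free energy
`log μ₁(e^A, z)`; `= m₂₂/D > 0`, tree `hasDerivAt_contactB_log`).  Both parities (`tendsto_varContacts_parity_div`) combined.
[cite: DemboZeitouni2010, §2.3 (Gärtner–Ellis; lane statement: variance density = curvature of the limiting free energy); BeatonBousquetMelouDeGierDuminilCopinGuttmann2014, §3.2 Proposition 6 (arXiv v5 p. 10: μ_T(y,z)); JansevanRensburg2000, §3.3 (1st ed.: fluctuations of the energy in adsorption models); MadrasSlade1993, §1.1 eq. (1.1.4) p. 5] -/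
theorem tendsto_varContacts_div (hy : 0 < y) (hz : 0 < z) :
    Tendsto (fun N : ℕ => varContacts y z N / N) atTop (𝓝 (deriv (fun A => contactB (Real.exp A) z) (Real.log y))) := by
  set β := deriv (fun A => contactB (Real.exp A) z) (Real.log y) with hβ
  have h0 := tendsto_varContacts_parity_div hy hz (c := 0) (by norm_num)
  have h1 := tendsto_varContacts_parity_div hy hz (c := 1) (by norm_num)
  rw [← hβ] at h0 h1
  apply tendsto_of_tendsto_even_odd
  · have h := h0.mul_const (1 / 2 : ℝ)
    rw [show 2 * β * (1 / 2) = β by ring] at h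
    refine h.congr' ?_
    filter_upwards [eventually_ge_atTop 1] with M hM
    have hM0 : (M : ℝ) ≠ 0 := by exact_mod_cast (show M ≠ 0 by omega)
    simp only [add_zero]
    push_cast
    field_simp
  · have h := h1.mul tendsto_natCast_div_two_mul_add_one
    rw [show 2 * β * (1 / 2) = β by ring] at h
    refine h.congr' ?_
    filter_upwards [eventually_ge_atTop 1] with M hM
    have hM0 : (M : ℝ) ≠ 0 := by exact_mod_cast (show M ≠ 0 by omega)
    push_cast
    field_simp

/-- ★★★ **The rate in closed form**: `Var_{N,y,z}(bc)/N → m₂₂/(m₁₁m₂₂ − m₁₂²) > 0` with `b = b(y,z)`, `b' = b(z,y)` the two contact densities and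
`m₁₁ = 4/(1−2b−2b') + 8/(4b+2b'−1) + 2/(2b+4b'−1) − 1/b`, `m₁₂ = 4/(1−2b−2b') + 4/(4b+2b'−1) + 4/(2b+4b'−1)`,
`m₂₂ = 4/(1−2b−2b') + 2/(4b+2b'−1) + 8/(2b+4b'−1) − 1/b'` (the Hessian of the contact entropy at the typical pair).
[cite: DemboZeitouni2010, §2.2–§2.3 (lane statement); JansevanRensburg2000, §3.3 (1st ed.)] -/
theorem tendsto_varContacts_div_explicit (hy : 0 < y) (hz : 0 < z) :
    let b := contactB y z
    let b' := contactB z y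
    let m₁₁ := 4 / (1 - 2 * b - 2 * b') + 8 / (4 * b + 2 * b' - 1) + 2 / (2 * b + 4 * b' - 1) - 1 / b
    let m₁₂ := 4 / (1 - 2 * b - 2 * b') + 4 / (4 * b + 2 * b' - 1) + 4 / (2 * b + 4 * b' - 1)
    let m₂₂ := 4 / (1 - 2 * b - 2 * b') + 2 / (4 * b + 2 * b' - 1) + 8 / (2 * b + 4 * b' - 1) - 1 / b'
    Tendsto (fun N : ℕ => varContacts y z N / N) atTop (𝓝 (m₂₂ / (m₁₁ * m₂₂ - m₁₂ ^ 2))) ∧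
      0 < m₂₂ / (m₁₁ * m₂₂ - m₁₂ ^ 2) := by
  intro b b' m₁₁ m₁₂ m₂₂
  have h := hasDerivAt_contactB_log (Real.log y) (Real.log z)
  simp only [Real.exp_log hy, Real.exp_log hz] at h
  obtain ⟨-, -, dA, -, -, hpos, -⟩ := h
  have e : deriv (fun A => contactB (Real.exp A) z) (Real.log y) = m₂₂ / (m₁₁ * m₂₂ - m₁₂ ^ 2) := dA.deriv
  have := tendsto_varContacts_div hy hz
  rw [e] at this
  exact ⟨this, hpos⟩

/-- ★★★★ **THE UNIFORM STRIP**: for the plain SAW on the width-one brick-wall strip (`y = z = 1`, `μ = μ(S₁)` the plastic number),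
`Var_N(bc)/N → (21μ² + 95μ − 14)/1058 ∈ (0.1405, 0.1406)`: the number of bottom contacts of a uniform `N`-step strip walk has variance
`≈ 0.1405·N` (tree: `susceptibility_uniform`, `susceptibility_uniform_bounds`).
[cite: DemboZeitouni2010, §2.3 (lane statement); BeatonBousquetMelouDeGierDuminilCopinGuttmann2014, §3.2 Proposition 6 (arXiv v5 p. 10); MadrasSlade1993, §8.5 pp. 278–279 (one-dimensional lattices)] -/
theorem tendsto_varContacts_div_uniform :
    Tendsto (fun N : ℕ => varContacts 1 1 N / N) atTop
        (𝓝 ((21 * stripConnectiveConstant 1 ^ 2 + 95 * stripConnectiveConstant 1 - 14) / 1058)) ∧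
      (0.1405 : ℝ) < (21 * stripConnectiveConstant 1 ^ 2 + 95 * stripConnectiveConstant 1 - 14) / 1058 ∧
      (21 * stripConnectiveConstant 1 ^ 2 + 95 * stripConnectiveConstant 1 - 14) / 1058 < 0.1406 := by
  have h := tendsto_varContacts_div one_pos one_pos
  rw [Real.log_one, susceptibility_uniform.1.deriv] at h
  obtain ⟨b1, b2, -, -⟩ := susceptibility_uniform_bounds
  exact ⟨h, b1, b2⟩

end WidthOneYZ

end Literature.Probability.RandomPlanarGeometry.SAW.HexBW
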